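import Mathlib.Analysis.SpecialFunctions.Trigonometric.Arctan
import Summits.KontsevichZagierPeriods.KontsevichZagierPeriods.Theorems.HurwitzMicroSectorsNormalFormPrincipleAlgCarriers
import Summits.KontsevichZagierPeriods.KontsevichZagierPeriods.Theorems.HurwitzMicroSectorsNormalFormPrincipleSiegeNfAPoleOneK3
import Summits.KontsevichZagierPeriods.KontsevichZagierPeriods.Theorems.HurwitzMicroSectorsNormalFormPrincipleAngAddK2

/-!
# `NormalFormPrinciple` (stmt-KontsevichZagierPeriods-3869), line `SketchIdeator1` —
# the leaf `stub_boxRigidity` in dimension one — the arctangent representations and carriers `T(t, d)`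

Pure proof file (lead seat c3; `--supports` the crux). The arctangent representations
`[(a,b), d/(1+y²)]` with real algebraic data (existence, value `d(arctan b − arctan a)`, reflection
`y ↦ −y`), a fixed family of arctangent carriers `RG t d = [(0,t), d/(1+y²)]`, additivity and
`ℤ`-linearity in `d`, and `ang_interval_eq`: every arctangent interval is a sum of two carriers with
`tᵢ ≥ 0`. The rotation move and the tangent addition law by moves are the sibling files
`…AngARotateK3`, `…AngAddK2`; the affine move is `…SiegeNfAPoleOneK3`.

Sources: M. Kontsevich, D. Zagier, *Periods* (2001), §1.2 rules (1), (2). No definitions are introduced.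
-/

noncomputable section

open MeasureTheory Set Finset
open scoped Polynomial
open Literature.NumberTheory.Transcendental Literature.NumberTheory.Transcendental.KZ
open Literature.ModelTheory.ExponentialFields (IsSemialgebraic isSemialgebraic_univ)

namespace Summit.KontsevichZagierPeriods.HurwitzMicroSectors.NormalFormPrinciple.PiBox

namespace Dlog

open Summit.KontsevichZagierPeriods.HurwitzMicroSectors.NormalFormPrinciple.Negative
  (setIntegral_fin_one integrableOn_fin_one)

/-! ## General one-domain moves -/

/-- **Merging on one domain** (rule 1b): representations `L, L₁, L₂` on one domain `σ` with
integrands `f₁ + f₂`, `f₁`, `f₂` (on `σ`) give `[L] − [L₁] − [L₂] ∈ relations`.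
[cite: KontsevichZagier2001, §1.2 rule (1)] -/
theorem merge_mem_relations {σ : Set (Fin 1 → ℝ)} {f₁ f₂ : (Fin 1 → ℝ) → ℝ} (L L₁ L₂ : IntegralRep 1)
    (hd : L.domain = σ) (hd₁ : L₁.domain = σ) (hd₂ : L₂.domain = σ)
    (hi : EqOn L.integrand (f₁ + f₂) L.domain) (hi₁ : EqOn L₁.integrand f₁ L₁.domain)
    (hi₂ : EqOn L₂.integrand f₂ L₂.domain) : of L - of L₁ - of L₂ ∈ relations := by
  refine integrandAddRel_subset_relations ⟨1, L, L₁, L₂, hd₁.trans hd.symm, hd₂.trans hd.symm,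
    fun x hx => ?_, rfl⟩
  rw [Pi.add_apply, hi hx, hi₁ (by rw [hd₁, ← hd]; exact hx), hi₂ (by rw [hd₂, ← hd]; exact hx)]
  rfl

/-- Congruence on one domain. [cite: KontsevichZagier2001, §1.2 rule (1)] -/
theorem congr_mem_relations {σ : Set (Fin 1 → ℝ)} {f : (Fin 1 → ℝ) → ℝ} (L L' : IntegralRep 1)
    (hd : L.domain = σ) (hd' : L'.domain = σ) (hi : EqOn L.integrand f L.domain)
    (hi' : EqOn L'.integrand f L'.domain) : of L - of L' ∈ relations :=
  of_sub_of_mem_relations_of_eqOn (hd'.trans hd.symm) fun x hx => by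
    rw [hi hx, hi' (by rw [hd', ← hd]; exact hx)]

/-! ## The arctangent representations -/

/-- **Existence**: `[(a,b), d/(1+y²)]` for real algebraic `a, b, d`. [cite: KontsevichZagier2001, §1.1] -/
theorem exists_angA {a b d : ℝ} (ha : IsAlgebraic ℚ a) (hb : IsAlgebraic ℚ b) (hd : IsAlgebraic ℚ d) :
    ∃ L : IntegralRep 1, L.domain = {x | x 0 ∈ Set.Ioo a b} ∧ L.integrand = fun x => d / (1 + x 0 ^ 2) := by
  have hdom := isSemialgebraic_setOf_apply_mem_Ioo_of_isAlgebraic ha hb (0 : Fin 1)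
  have hden : IsSemialgebraicFunOn ℚ {x : Fin 1 → ℝ | x 0 ∈ Set.Ioo a b} (fun x => 1 + x 0 ^ 2) :=
    (isSemialgebraicFunOn_aeval hdom (1 + (MvPolynomial.X 0 : MvPolynomial (Fin 1) ℚ) ^ 2)).congr
      fun x _ => by simp
  have hsa : IsSemialgebraicFunOn ℚ {x : Fin 1 → ℝ | x 0 ∈ Set.Ioo a b} (fun x => d / (1 + x 0 ^ 2)) :=
    (isSemialgebraicFunOn_const_of_isAlgebraic hdom hd).div hden fun x _ => by positivity
  have hint : IntegrableOn (fun x : Fin 1 → ℝ => d / (1 + x 0 ^ 2)) {x : Fin 1 → ℝ | x 0 ∈ Set.Ioo a b} := by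
    rw [integrableOn_fin_one]
    have hcont : Continuous (fun t : ℝ => d / (1 + t ^ 2)) :=
      continuous_const.div (by fun_prop) fun t => by positivity
    exact (hcont.continuousOn.integrableOn_compact isCompact_Icc).mono_set Set.Ioo_subset_Icc_self
  exact ⟨⟨_, _, hdom, hsa, hint⟩, rfl, rfl⟩

/-- **Value**: `∫_{(a,b)} d/(1+y²) dy = d (arctan b − arctan a)` for `a ≤ b`.
[cite: KontsevichZagier2001, §1.1] -/
theorem value_angA {a b d : ℝ} (L : IntegralRep 1) (hdL : L.domain = {x | x 0 ∈ Set.Ioo a b})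
    (hi : EqOn L.integrand (fun x => d / (1 + x 0 ^ 2)) L.domain) (hab : a ≤ b) :
    L.value = d * (Real.arctan b - Real.arctan a) := by
  rw [IntegralRep.value, setIntegral_congr_fun (IsSemialgebraic.measurableSet_holds
    L.isSemialgebraic_domain) hi, hdL, setIntegral_fin_one (fun x => d / (1 + x 0 ^ 2)) (Set.Ioo a b)]
  simp only
  rw [← integral_Ioc_eq_integral_Ioo, ← intervalIntegral.integral_of_le hab]
  have : (fun t : ℝ => d / (1 + t ^ 2)) = fun t => d * (1 / (1 + t ^ 2)) := by
    funext t; rw [mul_one_div]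
  rw [this, intervalIntegral.integral_const_mul, integral_one_div_one_add_sq]

/-- Zero constant: `[(a,b), 0/(1+y²)] ∈ relations`. [cite: KontsevichZagier2001, §1.2] -/
theorem angA_zero_mem_relations (L : IntegralRep 1)
    (hi : EqOn L.integrand (fun x => (0:ℝ) / (1 + x 0 ^ 2)) L.domain) : of L ∈ relations :=
  of_mem_relations_of_eqOn_zero L fun x hx => by simp [hi hx]

/-- **Reflection** (rule 2): `[(a,b), d/(1+y²)] − [(−b,−a), d/(1+y²)] ∈ relations` (`y ↦ −y`).
[cite: KontsevichZagier2001, §1.2 rule (2)] -/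
theorem angA_reflect_mem_relations {a b d : ℝ} (L L' : IntegralRep 1)
    (hdL : L.domain = {x | x 0 ∈ Set.Ioo a b}) (hdL' : L'.domain = {x | x 0 ∈ Set.Ioo (-b) (-a)})
    (hi : EqOn L.integrand (fun x => d / (1 + x 0 ^ 2)) L.domain)
    (hi' : EqOn L'.integrand (fun x => d / (1 + x 0 ^ 2)) L'.domain) : of L - of L' ∈ relations := by
  refine SiegeK3.affineA_sub_mem_relations (s := -1) (t := 0) isAlgebraic_one.neg isAlgebraic_zero (by norm_num)
    L L' (fun y => d / (1 + y ^ 2)) ?_ hi' fun x hx => ?_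
  · rw [hdL, hdL']
    ext y
    simp only [Set.mem_setOf_eq, Set.mem_image, Set.mem_Ioo]
    constructor
    · rintro ⟨h1, h2⟩
      refine ⟨fun _ => -y 0, ⟨by linarith, by linarith⟩, ?_⟩
      funext i
      obtain rfl : i = 0 := Fin.fin_one_eq_zero i
      ring
    · rintro ⟨x, ⟨h1, h2⟩, rfl⟩
      constructor <;> linarith
  · rw [hi hx]
    show d / (1 + x 0 ^ 2) = d / (1 + (-1 * x 0 + 0) ^ 2) * |(-1:ℝ)|
    rw [abs_neg, abs_one, mul_one]
    ring

/-! ## The carrier family -/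

/-- **A family of arctangent carriers** `RG t d = [(0,t), d/(1+y²)]` for real algebraic `t, d` (junk
otherwise). [cite: KontsevichZagier2001, §1.1] -/
theorem exists_angCarrier :
    ∃ RG : ℝ → ℝ → IntegralRep 1, ∀ t d, IsAlgebraic ℚ t → IsAlgebraic ℚ d →
      (RG t d).domain = {x | x 0 ∈ Set.Ioo 0 t} ∧ (RG t d).integrand = fun x => d / (1 + x 0 ^ 2) := by
  classical
  refine ⟨fun t d => if h : IsAlgebraic ℚ t ∧ IsAlgebraic ℚ d then
    Classical.choose (exists_angA isAlgebraic_zero h.1 h.2) else IntegralRep.empty 1, fun t d ht hd => ?_⟩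
  dsimp only
  rw [dif_pos (show IsAlgebraic ℚ t ∧ IsAlgebraic ℚ d from ⟨ht, hd⟩)]
  exact Classical.choose_spec (exists_angA isAlgebraic_zero ht hd)

/-! ## Additivity in the constant -/

/-- `T(t, d + d') − T(t, d) − T(t, d') ∈ relations`. [cite: KontsevichZagier2001, §1.2 rule (1)] -/
theorem ang_add_const_mem_relations {RG : ℝ → ℝ → IntegralRep 1}
    (hRG : ∀ t d, IsAlgebraic ℚ t → IsAlgebraic ℚ d →
      (RG t d).domain = {x | x 0 ∈ Set.Ioo 0 t} ∧ (RG t d).integrand = fun x => d / (1 + x 0 ^ 2))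
    {t d d' : ℝ} (ht : IsAlgebraic ℚ t) (hd : IsAlgebraic ℚ d) (hd' : IsAlgebraic ℚ d') :
    of (RG t (d + d')) - of (RG t d) - of (RG t d') ∈ relations := by
  refine merge_mem_relations (σ := {x | x 0 ∈ Set.Ioo (0:ℝ) t})
    (f₁ := fun x => d / (1 + x 0 ^ 2)) (f₂ := fun x => d' / (1 + x 0 ^ 2)) _ _ _
    (hRG t _ ht (hd.add hd')).1 (hRG t d ht hd).1 (hRG t d' ht hd').1 ?_
    (by rw [(hRG t d ht hd).2]; exact fun _ _ => rfl) (by rw [(hRG t d' ht hd').2]; exact fun _ _ => rfl)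
  rw [(hRG t _ ht (hd.add hd')).2]
  intro x _
  show (d + d') / (1 + x 0 ^ 2) = d / (1 + x 0 ^ 2) + d' / (1 + x 0 ^ 2)
  rw [add_div]

/-- `T(t, 0) ∈ relations`. [cite: KontsevichZagier2001, §1.2 rule (1)] -/
theorem ang_zero_mem_relations {RG : ℝ → ℝ → IntegralRep 1}
    (hRG : ∀ t d, IsAlgebraic ℚ t → IsAlgebraic ℚ d →
      (RG t d).domain = {x | x 0 ∈ Set.Ioo 0 t} ∧ (RG t d).integrand = fun x => d / (1 + x 0 ^ 2))
    {t : ℝ} (ht : IsAlgebraic ℚ t) : of (RG t 0) ∈ relations :=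
  angA_zero_mem_relations _ (by rw [(hRG t 0 ht isAlgebraic_zero).2]; exact fun _ _ => rfl)

/-- Additivity in the quotient. [cite: KontsevichZagier2001, §1.2 rule (1)] -/
theorem ang_add_const_eq {RG : ℝ → ℝ → IntegralRep 1}
    (hRG : ∀ t d, IsAlgebraic ℚ t → IsAlgebraic ℚ d →
      (RG t d).domain = {x | x 0 ∈ Set.Ioo 0 t} ∧ (RG t d).integrand = fun x => d / (1 + x 0 ^ 2))
    {t d d' : ℝ} (ht : IsAlgebraic ℚ t) (hd : IsAlgebraic ℚ d) (hd' : IsAlgebraic ℚ d') :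
    QuotientAddGroup.mk' relations (of (RG t (d + d'))) =
      QuotientAddGroup.mk' relations (of (RG t d)) + QuotientAddGroup.mk' relations (of (RG t d')) := by
  have h := ang_add_const_mem_relations hRG ht hd hd'
  rw [← QuotientAddGroup.eq_zero_iff] at h
  change QuotientAddGroup.mk' relations _ = 0 at h
  rwa [map_sub, map_sub, sub_sub, sub_eq_zero] at h

/-- Negation in the quotient. [cite: KontsevichZagier2001, §1.2 rule (1)] -/
theorem ang_neg_eq {RG : ℝ → ℝ → IntegralRep 1}
    (hRG : ∀ t d, IsAlgebraic ℚ t → IsAlgebraic ℚ d →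
      (RG t d).domain = {x | x 0 ∈ Set.Ioo 0 t} ∧ (RG t d).integrand = fun x => d / (1 + x 0 ^ 2))
    {t d : ℝ} (ht : IsAlgebraic ℚ t) (hd : IsAlgebraic ℚ d) :
    QuotientAddGroup.mk' relations (of (RG t (-d))) = -QuotientAddGroup.mk' relations (of (RG t d)) := by
  have h := ang_add_const_eq hRG ht hd hd.neg
  have h0 : QuotientAddGroup.mk' relations (of (RG t 0)) = 0 :=
    (QuotientAddGroup.eq_zero_iff _).mpr (ang_zero_mem_relations hRG ht)
  rw [add_neg_cancel, h0] at h
  exact (neg_eq_of_add_eq_zero_right h.symm).symm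

/-- Integer multiples: `z • T(t, d) = T(t, z d)`. [cite: KontsevichZagier2001, §1.2 rule (1)] -/
theorem ang_zsmul_eq {RG : ℝ → ℝ → IntegralRep 1}
    (hRG : ∀ t d, IsAlgebraic ℚ t → IsAlgebraic ℚ d →
      (RG t d).domain = {x | x 0 ∈ Set.Ioo 0 t} ∧ (RG t d).integrand = fun x => d / (1 + x 0 ^ 2))
    {t d : ℝ} (ht : IsAlgebraic ℚ t) (hd : IsAlgebraic ℚ d) (z : ℤ) :
    z • QuotientAddGroup.mk' relations (of (RG t d)) =
      QuotientAddGroup.mk' relations (of (RG t ((z:ℝ) * d))) := by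
  have hnat : ∀ n : ℕ, n • QuotientAddGroup.mk' relations (of (RG t d)) =
      QuotientAddGroup.mk' relations (of (RG t ((n:ℝ) * d))) := by
    intro n
    induction n with
    | zero =>
      rw [zero_smul, Nat.cast_zero, zero_mul]
      exact ((QuotientAddGroup.eq_zero_iff _).mpr (ang_zero_mem_relations hRG ht)).symm
    | succ n ih =>
      rw [add_smul, one_smul, ih, Nat.cast_succ, add_mul, one_mul,
        ang_add_const_eq hRG ht ((isAlgebraic_nat (R := ℚ) n).mul hd) hd]
  cases z with
  | ofNat n => rw [Int.ofNat_eq_natCast, natCast_zsmul, hnat n, Int.cast_natCast]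
  | negSucc n =>
    rw [negSucc_zsmul, hnat (n + 1), Int.cast_negSucc, neg_mul,
      ang_neg_eq hRG ht ((isAlgebraic_nat (R := ℚ) (n + 1)).mul hd)]

/-- Finite sums in the constant. [cite: KontsevichZagier2001, §1.2 rule (1)] -/
theorem ang_sum_eq {RG : ℝ → ℝ → IntegralRep 1} {ι : Type*} (s : Finset ι) (f : ι → ℝ)
    (hRG : ∀ t d, IsAlgebraic ℚ t → IsAlgebraic ℚ d →
      (RG t d).domain = {x | x 0 ∈ Set.Ioo 0 t} ∧ (RG t d).integrand = fun x => d / (1 + x 0 ^ 2))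
    {t : ℝ} (ht : IsAlgebraic ℚ t) (hf : ∀ i ∈ s, IsAlgebraic ℚ (f i)) :
    QuotientAddGroup.mk' relations (of (RG t (∑ i ∈ s, f i))) =
      ∑ i ∈ s, QuotientAddGroup.mk' relations (of (RG t (f i))) := by
  classical
  induction s using Finset.induction_on with
  | empty =>
    rw [Finset.sum_empty, Finset.sum_empty]
    exact (QuotientAddGroup.eq_zero_iff _).mpr (ang_zero_mem_relations hRG ht)
  | insert i s hi ih =>
    rw [Finset.sum_insert hi, Finset.sum_insert hi,
      ang_add_const_eq hRG ht (hf i (Finset.mem_insert_self i s))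
        (Finset.sum_induction _ (IsAlgebraic ℚ) (fun _ _ ha hb => ha.add hb) isAlgebraic_zero fun j hj => hf j (Finset.mem_insert_of_mem hj)),
      ih fun j hj => hf j (Finset.mem_insert_of_mem hj)]

/-! ## Intervals on carriers -/

/-- **An arctangent interval is a sum of two carriers**: for real algebraic `a ≤ b` and `d`,
`[(a,b), d/(1+y²)] = T(t₁, d₁) + T(t₂, d₂)` modulo relations with algebraic `t₁, t₂ ≥ 0` and
`d₁, d₂ ∈ {d, −d}` (split at `0`, reflect the negative part). [cite: KontsevichZagier2001, §1.2 rules (1), (2)] -/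
theorem ang_interval_eq {RG : ℝ → ℝ → IntegralRep 1}
    (hRG : ∀ t d, IsAlgebraic ℚ t → IsAlgebraic ℚ d →
      (RG t d).domain = {x | x 0 ∈ Set.Ioo 0 t} ∧ (RG t d).integrand = fun x => d / (1 + x 0 ^ 2))
    {a b d : ℝ} (ha : IsAlgebraic ℚ a) (hb : IsAlgebraic ℚ b) (hd : IsAlgebraic ℚ d) (hab : a ≤ b)
    (L : IntegralRep 1) (hdL : L.domain = {x | x 0 ∈ Set.Ioo a b})
    (hi : EqOn L.integrand (fun x => d / (1 + x 0 ^ 2)) L.domain) :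
    ∃ t₁ t₂ d₁ d₂ : ℝ, 0 ≤ t₁ ∧ 0 ≤ t₂ ∧ IsAlgebraic ℚ t₁ ∧ IsAlgebraic ℚ t₂ ∧
      IsAlgebraic ℚ d₁ ∧ IsAlgebraic ℚ d₂ ∧
      QuotientAddGroup.mk' relations (of L) =
        QuotientAddGroup.mk' relations (of (RG t₁ d₁)) + QuotientAddGroup.mk' relations (of (RG t₂ d₂)) := by
  -- helper: the non-negative case `0 ≤ a ≤ b`: `[L] = T(b, d) − T(a, d)`
  have key : ∀ {a' b' : ℝ}, IsAlgebraic ℚ a' → IsAlgebraic ℚ b' → 0 ≤ a' → a' ≤ b' →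
      ∀ (L' : IntegralRep 1), L'.domain = {x | x 0 ∈ Set.Ioo a' b'} →
      EqOn L'.integrand (fun x => d / (1 + x 0 ^ 2)) L'.domain →
      QuotientAddGroup.mk' relations (of L') =
        QuotientAddGroup.mk' relations (of (RG b' d)) + QuotientAddGroup.mk' relations (of (RG a' (-d))) := by
    intro a' b' ha' hb' ha0 hab' L' hdL' hi'
    have h1 := hRG b' d hb' hd
    have h2 := hRG a' d ha' hd
    have hsplit : of (RG b' d) - of (RG a' d) - of L' ∈ relations :=
      split_mem_relations _ _ _ h1.1 h2.1 hdL' ha0 hab' (by rw [h2.2, h1.2]; exact fun _ _ => rfl)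
        (by rw [h1.2]; exact hi')
    rw [← QuotientAddGroup.eq_zero_iff] at hsplit
    change QuotientAddGroup.mk' relations _ = 0 at hsplit
    rw [map_sub, map_sub, sub_eq_zero] at hsplit
    rw [← hsplit, ang_neg_eq hRG ha' hd]
    abel
  by_cases ha0 : 0 ≤ a
  · exact ⟨b, a, d, -d, ha0.trans hab, ha0, hb, ha, hd, hd.neg, key ha hb ha0 hab L hdL hi⟩
  · have ha0' : a < 0 := not_le.mp ha0
    by_cases hb0 : b ≤ 0
    · -- reflect `(a,b)` onto `(−b,−a)` with `0 ≤ −b ≤ −a`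
      obtain ⟨L', hdL', hiL'⟩ := exists_angA hb.neg ha.neg hd
      have hrefl : of L - of L' ∈ relations := angA_reflect_mem_relations L L' hdL hdL' hi
        (by rw [hiL']; exact fun _ _ => rfl)
      rw [← QuotientAddGroup.eq_zero_iff] at hrefl
      change QuotientAddGroup.mk' relations _ = 0 at hrefl
      rw [map_sub, sub_eq_zero] at hrefl
      refine ⟨-a, -b, d, -d, by linarith, by linarith, ha.neg, hb.neg, hd, hd.neg, ?_⟩
      rw [hrefl]
      exact key hb.neg ha.neg (by linarith) (by linarith) L' hdL' (by rw [hiL']; exact fun _ _ => rfl)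
    · have hb0' : 0 < b := not_le.mp hb0
      -- split at `0`: `(a,0)` reflected onto `(0,−a)`, and `(0,b)`
      obtain ⟨L₁, hdL₁, hiL₁⟩ := exists_angA ha isAlgebraic_zero hd
      have h2 := hRG b d hb hd
      have hsplit : of L - of L₁ - of (RG b d) ∈ relations := by
        refine split_mem_relations _ _ _ hdL hdL₁ h2.1 ha0'.le hb0'.le ?_ ?_
        · intro x hx
          rw [hiL₁]
          have hx' : x ∈ L.domain := by
            rw [hdL]; rw [hdL₁] at hx; exact ⟨hx.1, lt_trans hx.2 hb0'⟩
          exact (hi hx').symm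
        · intro x hx
          rw [h2.2]
          have hx' : x ∈ L.domain := by
            rw [hdL]; rw [h2.1] at hx; exact ⟨lt_trans ha0' hx.1, hx.2⟩
          exact (hi hx').symm
      have h3 := hRG (-a) d ha.neg hd
      have hrefl : of L₁ - of (RG (-a) d) ∈ relations :=
        angA_reflect_mem_relations L₁ (RG (-a) d) hdL₁ (by rw [h3.1, neg_zero])
          (by rw [hiL₁]; exact fun _ _ => rfl) (by rw [h3.2]; exact fun _ _ => rfl)
      rw [← QuotientAddGroup.eq_zero_iff] at hsplit hrefl
      change QuotientAddGroup.mk' relations _ = 0 at hsplit hrefl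
      rw [map_sub, map_sub, sub_sub, sub_eq_zero] at hsplit
      rw [map_sub, sub_eq_zero] at hrefl
      refine ⟨-a, b, d, d, by linarith, hb0'.le, ha.neg, hb, hd, hd, ?_⟩
      rw [hsplit, hrefl]

end Dlog

end Summit.KontsevichZagierPeriods.HurwitzMicroSectors.NormalFormPrinciple.PiBox
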